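import Summits.CriticalPhenomena.PercolationContinuityZ3.Theorems.FK.Transplant.KNFreeStepIVInterface
import Summits.CriticalPhenomena.PercolationContinuityZ3.Theorems.FK.Transplant.KNFreeTargetWindow
import Summits.CriticalPhenomena.PercolationContinuityZ3.Theorems.FK.Transplant.FreeBoundaryHypothesesKN
import HarnessLib

/-!
# FRONTIER TRANSPLANT, binder 2 (TP_FK): Kozma–Nitzan's target Lemma 10 for the law of record `fkLaw Λ W q`,
# `q ≥ 1`, from an ABSTRACT STEP-IV SUPPLIER — the skeleton `fkTargetAt_of_fkStepIV`

Support file (`--supports stmt-CriticalPhenomena-4575`, helper) of the FRONTIER TRANSPLANT sub-cell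
(`fk-continuity/transplant/`, seat `prim-bschramm-fkt-p3`); builds on p205010 (kernel theorem, internal audit signed;
external expert review pending). No definitions, no named facts, no sorries; standard axioms. The interface
`FKStepIVAt` lives in `KNFreeStepIVInterface.lean`.
Registered R62 (cell INBOX l.4588, 2026-08-23); registry row T2s; lead label T2s-A1 (fkt-lead L21, l.4604).

HONEST FRAMING (page 1, cell rule). The transplant's theorem of record `ufsc0_of_freeBoundaryHypothesis_r3`
(p248245) is CONDITIONAL on FH AND on TP_FK = `KNFreeTargetHittable d q p`, both OPEN at the same `p` for `q > 1`
(⇔ GRC Conj. (5.103) via K1; barrier note `Literature.Barriers.CriticalPhenomena.SamePFreeBoundaryCriteria`,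
FBN-01, cited first); the transplant is a typed reduction, not a proof of FK continuity. THIS FILE changes none of
that: it is a REFACTORING of the window target lemma T2w (`fkTargetAt_of_isHittable_comparison`,
`KNFreeTargetWindow.lean`) in which Kozma–Nitzan's Step IV — the ONLY step of Lemma 10 that does not transplant to
`fkLaw` from same-`p` free-boundary inputs (CHAIN-MAP §D addenda 2–3; lineage note T2-STEPIV-OBSTACLE) — is
ABSTRACTED into the hypothesis `FKStepIVAt`. NOT `KNFreeTargetHittable`, NOT a binder discharge, NOT `_r4`; nothing
at `p ↓ p_c(q)`; `_r3` « 2 / 0 ☑ », n_open = 2, BINDER-OWNERS, FO-19 NO-GO unchanged.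

* `fkTargetAt_of_fkStepIV` — **KN Lemma 10 for `fkLaw`, `q ≥ 1`, from any supplier**: for `0 < p < 1` and `ε > 0`
  there is `δ = δ(ε) ∈ (0, 1]` (INDEPENDENT of `H`) such that every family `H` with a supplier
  `FKStepIVAt q p δ H M j₀ R₀` admits `R` with `FKTargetAt d q p δ ε H R`. Proof = T2w's skeleton VERBATIM (Step I
  constants; Steps II–III = the landed seeds engine `KNFree.exists_level_real_Gev_gt` with FK finite energy;
  Conjecture 3 ↦ the FK set-target gluing `fkLaw_setTarget_gluing_in`; Step V = `stepV_in_fkLaw`), with the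
  Step-IV block replaced by the hypothesis at the level found.
* `fkTargetAt_of_fkStepIV_class` — the same for a class of geometries `C` supplied at every tolerance `δ ∈ (0,1]`.
* `knFreeTargetHittable_of_fkStepIV` — **binder 2 LITERALLY from a supplier for every finite family of FK-hittable
  geometries at every tolerance** (`0 < p < 1`): the kernel form of "the open content of TP_FK is Step IV".

Instances (`KNFreeTargetStepIVInstances.lean`): the comparison supplier of T2w (`P_{p̃}`-hittable families in the
Bernoulli window); the record's conclusion from suppliers for the box families (with `UFSC0TargetMatrices.lean`).
The MEMO row T4-SLAB (R60; slab Step IV for the codimension-1 axis-box class from `Π(p, L)`, UNFUNDED) would be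
the supplier `FKStepIVAt` for `IsBoxGeom` families — its packages (P4)/(P6) reduce to that supplier.

## References

* G. Kozma, S. Nitzan, arXiv:2401.12397 (2024), §4 Lemma 10 (pp. 17–22) [KozmaNitzan2024].
* G. Grimmett, *The Random-Cluster Model*, Springer 2006, §1.4 (1.20), Thm. (3.1) (3.4), Thm. (3.7), Thm. (3.21)
  eqs. (3.22)/(3.23), Conj. (5.103) [Grimmett2006].
-/

noncomputable section

open MeasureTheory
open scoped ENNReal Classical

namespace Summit.CriticalPhenomena.PercolationContinuityZ3.Theorems.FK

open Literature.Probability.Percolation Literature.Probability.LatticeModels SimpleGraph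
open Literature.Probability.Percolation.KozmaNitzan Transplant

variable {d : ℕ}

/-! ### KN Lemma 10 for `fkLaw` from a supplier -/

/-- **Kozma–Nitzan's Lemma 10 for the random-cluster law `fkLaw`, `q ≥ 1`, FROM ANY STEP-IV SUPPLIER.**
`0 < p < 1`. For every `ε > 0` there is `δ > 0`, depending on `ε` only, such that every finite family `H` of geometries
with a Step-IV supplier `FKStepIVAt q p δ H M j₀ R₀` admits an `R` with `FKTargetAt d q p δ ε H R`: for every finitely
supported weighting `W` on `Sfin` with a lattice subbox `D ⊇ B⟨R⟩` at `p`, every nonempty target `T ⊆ D` w.r.t.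
`(B, D, R, H)` and every source `o ∉ D`, `φ(o ↔ B) > 1 - δ ⟹ φ(o ↔ T) > 1 - ε`, `φ = fkLaw Sfin W q`.
Proof = KN pp. 17–22 exactly as in T2w `fkTargetAt_of_isHittable_comparison`: Step I constants `δ_{C3} = min(ε/4,1)`,
`δ = ε δ_{C3}/12`; Steps II–III = the seeds engine `KNFree.exists_level_real_Gev_gt` (FK insertion constant
`π = p/(p+q(1-p))`, deletion constant `1-p`) over the levels `Icc j₀' j₁`, `j₀' = max (2M+2) j₀`; Conjecture 3 ↦ the FK
set-target gluing `fkLaw_setTarget_gluing_in`; Step IV = THE HYPOTHESIS at the level found; Step V = `stepV_in_fkLaw`.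
[cite: KozmaNitzan2024, §4 Lemma 10 (pp. 17–22); Grimmett2006, Thm. (3.7), Thm. (3.1) eq. (3.4)] -/
theorem fkTargetAt_of_fkStepIV [NeZero d] {q : ℝ} (hq : 1 ≤ q) (p : unitInterval)
    (hp0 : 0 < (p : ℝ)) (hp1 : (p : ℝ) < 1) {ε : ℝ} (hε : 0 < ε) :
    ∃ δ : ℝ, 0 < δ ∧ δ ≤ 1 ∧ ∀ (H : List (Geom d)) (M j₀ R₀ : ℕ), FKStepIVAt q p δ H M j₀ R₀ →
      ∃ R : ℕ, FKTargetAt d q p δ ε H R := by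
  classical
  have hq0 : 0 < q := one_pos.trans_le hq
  -- trivial when `ε > 1`
  rcases le_or_gt ε 1 with hε1 | hε1
  swap
  · refine ⟨1, one_pos, le_rfl, fun H _ _ _ _ => ⟨0, fun W Sfin D lo hi T o _ _ _ _ _ _ _ _ _ _ => ?_⟩⟩
    haveI := isProbabilityMeasure_fkLaw Sfin W hq0
    exact lt_of_lt_of_le (by linarith) measureReal_nonneg
  -- Step I: the constants `δ_{C3} = ε/4`, `δ`
  set δc : ℝ := min (ε / 4) 1 with hδc
  have hδc0 : 0 < δc := lt_min (by positivity) one_pos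
  have hδc1 : δc ≤ 1 := min_le_right _ _
  have hδc4 : δc ≤ ε / 4 := min_le_left _ _
  set δ : ℝ := ε * δc / 12 with hδdef
  have hδpos : 0 < δ := by positivity
  have hδc' : δ ≤ δc := by rw [hδdef]; nlinarith
  have h3δ : 3 * δ ≤ 1 := by rw [hδdef]; nlinarith
  have h12 : 12 * δ ≤ ε * δc := by rw [hδdef]; linarith
  have hδ1 : δ ≤ 1 := by linarith
  refine ⟨δ, hδpos, hδ1, fun H M j₀ R₀ hsup => ?_⟩
  -- the number of seeds `k` (FK insertion constant `π = p/(p+q(1-p))`), of contacts `N`, of levels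
  set π : ℝ := (p : ℝ) / (p + q * (1 - p)) with hπ
  have hden : 0 < (p : ℝ) + q * (1 - p) := by nlinarith [p.2.2]
  have hπ0 : 0 < π := div_pos hp0 hden
  have hπ1 : π ≤ 1 := by rw [hπ, div_le_one hden]; nlinarith [p.2.2]
  set sM : ℕ := seedBound d M with hsM
  set qs : ℝ := 1 - π ^ sM with hqs
  have hqs0 : 0 ≤ qs := by rw [hqs, sub_nonneg]; exact pow_le_one₀ hπ0.le hπ1
  have hqs1 : qs < 1 := by rw [hqs]; linarith [pow_pos hπ0 sM]
  obtain ⟨k, hk⟩ := exists_pow_lt_of_lt_one hδpos hqs1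
  set N := LData.Ncont d M k with hN
  set K₀ : ℝ := 1 / (1 - (p : ℝ)) ^ (2 * d * N) with hK₀
  set Lcount : ℕ := ⌈K₀ / δ⌉₊ + 1 with hLcount
  set j₀' : ℕ := max (2 * M + 2) j₀ with hj₀'
  set j₁ : ℕ := j₀' + Lcount - 1 with hj₁
  set R : ℕ := max R₀ (j₁ + M + 2) with hR
  have hR₀R : R₀ ≤ R := le_max_left _ _
  have hRj : j₁ + M + 2 ≤ R := le_max_right _ _
  refine ⟨R, fun W Sfin D lo hi T o hfin hsub hDS ho hoD hBR htgt hTD hTne hreach => ?_⟩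
  set μ := fkLaw Sfin W q with hμ
  haveI hμP : IsProbabilityMeasure μ := isProbabilityMeasure_fkLaw Sfin W hq0
  -- `lo ≤ hi`, else `B = ∅`
  have hlohi : lo ≤ hi := by
    by_contra hlt
    have : Finset.Icc lo hi = ∅ := Finset.Icc_eq_empty hlt
    rw [this] at hreach
    simp only [Finset.notMem_empty, Set.iUnion_of_empty, Set.iUnion_empty, measureReal_empty] at hreach
    linarith
  -- the level data and hypotheses
  set L : LData d := ⟨lo, hi, o, Sfin⟩ with hLdef
  have hL : LHyp L W p D (R - 1) :=
    { sub := hsub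
      fin := hfin
      DS := hDS
      encl := by
        have : R - 1 + 1 = R := by omega
        rw [this]; exact hBR
      o_not := hoD
      o_mem := ho }
  -- Steps II–III for `fkLaw`: the three tolerance hypotheses of the engine
  have hWΛ : ∀ F : Finset (Sym2 (Site d)), (∀ e ∈ F, W e = p) → ∀ e ∈ F, ∀ z ∈ e, z ∈ Sfin := by
    intro F hF e he z hz
    refine KNFree.forall_mem_of_finSupp hfin (fun h0 => ?_) z hz
    have : ((W e : unitInterval) : ℝ) = 0 := by rw [h0]; rfl
    rw [hF e he] at this
    exact hp0.ne' this
  have hnull : μ.real (LData.PosOnly W)ᶜ = 0 := KNFree.real_fkLaw_compl_posOnly_eq_zero hq Sfin W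
  have hdel : ∀ (F : Finset (Sym2 (Site d))) (A : Set (BondConfig (Site d))), (∀ e ∈ F, W e = p) → MeasurableSet A →
      (1 - (p : ℝ)) ^ F.card * μ.real ((fun ω => ω \ ↑F) ⁻¹' A) ≤ μ.real A :=
    fun F A hF hA => KNFree.del_tolerance_fkLaw hq Sfin W hF (hWΛ F hF) hA
  have hins : ∀ (F : Finset (Sym2 (Site d))) (A : Set (BondConfig (Site d))), (∀ e ∈ F, W e = p) → MeasurableSet A →
      π ^ F.card * μ.real ((fun ω => ω ∪ ↑F) ⁻¹' A) ≤ μ.real A :=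
    fun F A hF hA => KNFree.ins_tolerance_fkLaw hq Sfin W hF (hWΛ F hF) hA
  have hj₁R : j₁ ≤ R - 1 := by omega
  have hcard : ((Finset.Icc j₀' j₁).card : ℝ) = Lcount := by
    rw [Nat.card_Icc]; congr 1; omega
  have hJ : 1 / (1 - (p : ℝ)) ^ (2 * d * N) ≤ δ * ((Finset.Icc j₀' j₁).card : ℝ) := by
    rw [hcard, hLcount]
    push_cast
    have h1 : K₀ / δ ≤ ⌈K₀ / δ⌉₊ := Nat.le_ceil _
    have h2 : K₀ = δ * (K₀ / δ) := by field_simp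
    rw [← hK₀]
    nlinarith
  have hwideJ : ∀ j ∈ Finset.Icc j₀' j₁, ∀ i, L.Lo j i + 2 * M + 2 ≤ L.Hi j i := by
    intro j hj i
    have hj₀j := (Finset.mem_Icc.1 hj).1
    have h2M : 2 * M + 2 ≤ j := (le_max_left _ _).trans hj₀j
    simp only [LData.Lo, LData.Hi, Pi.sub_apply, Pi.add_apply, Pi.natCast_apply]
    have : L.lo i ≤ L.hi i := hlohi i
    omega
  obtain ⟨j, hjJ, hG⟩ := KNFree.exists_level_real_Gev_gt μ hL hπ0.le hπ1 hnull hdel hins hp1 hj₁R hwideJ hJ hk.le hreach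
  obtain ⟨hj₀j, hjj₁⟩ := Finset.mem_Icc.1 hjJ
  have hjR : j ≤ R - 1 := hjj₁.trans hj₁R
  have hj₀le : j₀ ≤ j := (le_max_right _ _).trans hj₀j
  have hwide : ∀ k', L.Lo j k' + 2 * M + 2 ≤ L.Hi j k' := hwideJ j hjJ
  -- Step IV: THE SUPPLIER at the level found (shell, faces in the shell, relays)
  have htgt' : IsTarget T L.lo L.hi D R H := htgt
  have hjMR : j + M + 2 ≤ R := by omega
  obtain ⟨S, hS, hSD, hUS, hIV⟩ := hsup L W D T R j hL hR₀R hj₀le hjMR hwide htgt' hTD hTne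
  -- the gluing hypothesis: source `o ∉ D`, relays reliable to `T` inside `D`
  have hC3' : ∀ (w : Sym2 (Site d) → unitInterval), FinSupp w L.Sfin → ∀ (A : Finset (Site d)), A ⊆ L.Sfin →
      1 - δc < (fkLaw Sfin w q).real (⋃ a ∈ A, openConn L.o a) →
      (∀ a ∈ A, 1 - δc < (fkLaw Sfin w q).real (⋃ t ∈ T, openConnIn (↑D : Set (Site d)) a t)) →
      1 - ε / 2 < (fkLaw Sfin w q).real (⋃ t ∈ T, openConn L.o t) := by
    intro w _ A _ hoA haT
    have key := fkLaw_setTarget_gluing_in hq Sfin w A T ho (↑D : Set (Site d)) hδc0.le fun a ha => (haT a ha).le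
    change 1 - δc < (fkLaw Sfin w q).real (⋃ a ∈ A, openConn o a) at hoA
    change 1 - ε / 2 < (fkLaw Sfin w q).real (⋃ t ∈ T, openConn o t)
    linarith
  -- Step V
  exact stepV_in_fkLaw hL hq hp0 (Λ := Sfin) subset_rfl (Rg := (↑D : Set (Site d))) hjR hwide hS hSD hε hε1 hδpos
    hδc' h3δ h12 hG hUS hIV hC3'

/-- **The class form.** If every finite family from a class `C` of geometries has a Step-IV supplier at every
tolerance `δ ∈ (0, 1]`, then binder 2 holds RELATIVE TO `C`: `∀ ε > 0 ∃ δ > 0 ∀ H ⊆ C ∃ R, FKTargetAt d q p δ ε H R`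
(`0 < p < 1`). The shape of T2w (class `IsHittable p̃`) and of the memo row T4-SLAB (class `IsBoxGeom`).
[cite: KozmaNitzan2024, §4 Lemma 10 (pp. 17–22)] -/
theorem fkTargetAt_of_fkStepIV_class [NeZero d] {q : ℝ} (hq : 1 ≤ q) (p : unitInterval)
    (hp0 : 0 < (p : ℝ)) (hp1 : (p : ℝ) < 1) (C : Geom d → Prop)
    (hsup : ∀ ⦃δ : ℝ⦄, 0 < δ → δ ≤ 1 → ∀ H : List (Geom d), (∀ g ∈ H, C g) →
      ∃ M j₀ R₀ : ℕ, FKStepIVAt q p δ H M j₀ R₀)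
    {ε : ℝ} (hε : 0 < ε) :
    ∃ δ : ℝ, 0 < δ ∧ ∀ H : List (Geom d), (∀ g ∈ H, C g) → ∃ R : ℕ, FKTargetAt d q p δ ε H R := by
  obtain ⟨δ, hδ, hδ1, h⟩ := fkTargetAt_of_fkStepIV (d := d) hq p hp0 hp1 hε
  refine ⟨δ, hδ, fun H hH => ?_⟩
  obtain ⟨M, j₀, R₀, hs⟩ := hsup hδ hδ1 H hH
  exact h H M j₀ R₀ hs

/-- **Binder 2 LITERALLY from a Step-IV supplier for FK-hittable families** (`0 < p < 1`): if every finite family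
of FK(p,q)-hittable geometries has a Step-IV supplier at every tolerance `δ ∈ (0,1]`, then `KNFreeTargetHittable d q p`.
This is the kernel form of the cell's reading "the open content of TP_FK for `q > 1` is Step IV" (CHAIN-MAP §D
addendum 2): Steps I–III and V of Lemma 10 and the gluing hold for `fkLaw` at every `q ≥ 1`.
[cite: KozmaNitzan2024, §4 Lemma 10 (pp. 17–22); Grimmett2006, Conj. (5.103)] -/
theorem knFreeTargetHittable_of_fkStepIV [NeZero d] {q : ℝ} (hq : 1 ≤ q) (p : unitInterval)
    (hp0 : 0 < (p : ℝ)) (hp1 : (p : ℝ) < 1)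
    (hsup : ∀ ⦃δ : ℝ⦄, 0 < δ → δ ≤ 1 → ∀ H : List (Geom d), (∀ g ∈ H, IsHittableFK q p g) →
      ∃ M j₀ R₀ : ℕ, FKStepIVAt q p δ H M j₀ R₀) :
    KNFreeTargetHittable d q p :=
  fun _ hε => fkTargetAt_of_fkStepIV_class hq p hp0 hp1 (IsHittableFK q p) hsup hε

end Summit.CriticalPhenomena.PercolationContinuityZ3.Theorems.FK

end
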